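import Summits.AtomisticToContinuum.Crystallization.Theorems.GappedShellCensusTornFreeStubTfCircleTwo
import Summits.AtomisticToContinuum.Crystallization.Theorems.GappedShellCensusTornFreeStubTfReflexHub
import Summits.AtomisticToContinuum.Crystallization.Theorems.GappedShellCensusTornFreeStubTfPerpLower

/-!
# Crux `GappedShellCensus.TornFree` (stmt-AtomisticToContinuum-18069), line `Sketch` —
# the VOID DICHOTOMY (lead c1, skeleton v3)

The v2.2 content statement of line `Sketch` (a finite ALLGAP patch — every pair hard-core and
bond-or-far, every site at most twelve-coordinated, every site within `3a` of `y` exactly twelve —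
with a bond `(y, v)` of at most three common neighbours and an empty `120°` azimuthal sector is
contradictory, given the sector windows; it implies the crux through the landed transfer
`tornFree_of_noWideGapLocal`, p150126) follows from TWO PURE finite statements, split along the
combinatorics of the `≤ 3` commons:

* `A` (no REFLEX void): all commons lie in a closed half-plane about the bond axis
  (`⟪w − y, e⟫ ≤ 0` for a unit `e ⊥ v − y`) — forced when `c ≤ 2` (`stub_tfCircleTwo`, p154010)
  and when `c = 3` with a hub common bonded to the other two (sector windows give cosines `≥ 1/4`,
  `stub_tfReflexHub` p153989 turns them into a free sector of half-opening `104.5°` opposite the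
  hub, which is off-axis by `stub_tfPerpLower` p154076);
* `B` (no FAR TRIAD): `c = 3` with a common far (`≥ 1.26a`) from the other two — forced otherwise,
  because a common bonded to neither of the others is far from both under ALLGAP.

`tf_voidDichotomy : A → B → (v2.2 content statement)` is the kernel-checked case analysis; `A` and
`B` are the registered content stubs `stub_tfNoReflexVoid` / `stub_tfNoFarTriad` of skeleton v3
(Cruxes/TornFree/Lines/Sketch.lean), taken here as hypotheses.  No new definitions, no named facts.
-/

noncomputable section

namespace Summit.AtomisticToContinuum.Crystallization.Theorems

open Literature.Geometry.DiscreteGeometry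
open scoped RealInnerProductSpace

/-- A finite set of at most two points is covered by the values of a map out of `Fin 2`. -/
private theorem tfvd_enum2 {C : Set (EuclideanSpace ℝ (Fin 3))} (hC : C.Finite)
    (hC2 : C.ncard ≤ 2) (y : EuclideanSpace ℝ (Fin 3)) :
    ∃ w' : Fin 2 → EuclideanSpace ℝ (Fin 3), ∀ w ∈ C, ∃ i, w' i = w := by
  obtain ⟨n, f, hf⟩ := hC.fin_embedding
  have hn : n ≤ 2 := by
    have h := Set.ncard_range_of_injective f.injective
    rw [hf, Nat.card_eq_fintype_card, Fintype.card_fin] at h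
    omega
  refine ⟨fun i => if h : (i : ℕ) < n then f ⟨i, h⟩ else y, fun w hw => ?_⟩
  rw [← hf] at hw
  obtain ⟨k, rfl⟩ := hw
  exact ⟨⟨k, lt_of_lt_of_le k.2 hn⟩, by simp [k.2]⟩

/-- Pairing with a direction `e ⊥ b` only sees the component orthogonal to `b`. -/
private theorem tfvd_inner_eq (b x e : EuclideanSpace ℝ (Fin 3)) (heb : ⟪e, b⟫ = 0) :
    ⟪x, e⟫ = ⟪perpTo b x, e⟫ := by
  conv_lhs => rw [← perpTo_add_smul b x]
  rw [inner_add_left, real_inner_smul_left, real_inner_comm e b, heb, mul_zero, add_zero]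

/-- **The void dichotomy.** The v2.2 content statement (finite ALLGAP patch, bond
with `≤ 3` commons, empty `120°` sector, given the sector windows) follows from the two pure content
stubs: with `c ≤ 2` commons, or `c = 3` and a hub common bonded to the other two, the commons lie in
a closed half-plane about the axis (`stub_tfCircleTwo`; windows + `stub_tfReflexHub` +
`stub_tfPerpLower`) — `stub_tfNoReflexVoid`; otherwise some common is bonded to neither of the other
two, hence (ALLGAP) far from both — `stub_tfNoFarTriad`. -/
theorem tf_voidDichotomy :
    (∀ (Y : Set (EuclideanSpace ℝ (Fin 3))) (a : ℝ), 0 < a → Y.Finite →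
      (∀ p ∈ Y, ∀ q ∈ Y, p ≠ q → a * (1 - 1 / 50) ≤ dist p q ∧
        (dist p q ≤ a * (1 + 1 / 50) ∨ a * (63 / 50) ≤ dist p q)) →
      (∀ z ∈ Y, {w ∈ Y | w ≠ z ∧ dist z w ≤ a * (1 + 1 / 50)}.ncard ≤ 12) →
      ∀ y ∈ Y,
        (∀ z ∈ Y, dist y z ≤ a * 3 → {w ∈ Y | w ≠ z ∧ dist z w ≤ a * (1 + 1 / 50)}.ncard = 12) →
        ∀ v ∈ Y, v ≠ y → dist y v ≤ a * (1 + 1 / 50) →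
          {w ∈ Y | w ≠ y ∧ w ≠ v ∧ dist y w ≤ a * (1 + 1 / 50) ∧
              dist v w ≤ a * (1 + 1 / 50)}.ncard ≤ 3 →
          ∀ e : EuclideanSpace ℝ (Fin 3), ‖e‖ = 1 → ⟪e, v - y⟫ = 0 →
            (∀ w ∈ Y, w ≠ y → w ≠ v → dist y w ≤ a * (1 + 1 / 50) →
              dist v w ≤ a * (1 + 1 / 50) → ⟪w - y, e⟫ ≤ 0) →
            False) →
    (∀ (Y : Set (EuclideanSpace ℝ (Fin 3))) (a : ℝ), 0 < a → Y.Finite →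
      (∀ p ∈ Y, ∀ q ∈ Y, p ≠ q → a * (1 - 1 / 50) ≤ dist p q ∧
        (dist p q ≤ a * (1 + 1 / 50) ∨ a * (63 / 50) ≤ dist p q)) →
      (∀ z ∈ Y, {w ∈ Y | w ≠ z ∧ dist z w ≤ a * (1 + 1 / 50)}.ncard ≤ 12) →
      ∀ y ∈ Y,
        (∀ z ∈ Y, dist y z ≤ a * 3 → {w ∈ Y | w ≠ z ∧ dist z w ≤ a * (1 + 1 / 50)}.ncard = 12) →
        ∀ v ∈ Y, v ≠ y → dist y v ≤ a * (1 + 1 / 50) →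
          {w ∈ Y | w ≠ y ∧ w ≠ v ∧ dist y w ≤ a * (1 + 1 / 50) ∧
              dist v w ≤ a * (1 + 1 / 50)}.ncard ≤ 3 →
          ∀ w₁ ∈ Y, ∀ w₂ ∈ Y, ∀ w₃ ∈ Y,
            w₁ ≠ y → w₁ ≠ v → dist y w₁ ≤ a * (1 + 1 / 50) → dist v w₁ ≤ a * (1 + 1 / 50) →
            w₂ ≠ y → w₂ ≠ v → dist y w₂ ≤ a * (1 + 1 / 50) → dist v w₂ ≤ a * (1 + 1 / 50) →
            w₃ ≠ y → w₃ ≠ v → dist y w₃ ≤ a * (1 + 1 / 50) → dist v w₃ ≤ a * (1 + 1 / 50) →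
            w₁ ≠ w₂ → w₁ ≠ w₃ → w₂ ≠ w₃ →
            a * (63 / 50) ≤ dist w₁ w₃ → a * (63 / 50) ≤ dist w₂ w₃ →
            False) →
    (∀ (a : ℝ), 0 < a → ∀ y v w₁ w₂ : EuclideanSpace ℝ (Fin 3),
      a * (1 - 1 / 50) ≤ dist y v → dist y v ≤ a * (1 + 1 / 50) →
      a * (1 - 1 / 50) ≤ dist y w₁ → dist y w₁ ≤ a * (1 + 1 / 50) →
      a * (1 - 1 / 50) ≤ dist v w₁ → dist v w₁ ≤ a * (1 + 1 / 50) →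
      a * (1 - 1 / 50) ≤ dist y w₂ → dist y w₂ ≤ a * (1 + 1 / 50) →
      a * (1 - 1 / 50) ≤ dist v w₂ → dist v w₂ ≤ a * (1 + 1 / 50) →
      a * (1 - 1 / 50) ≤ dist w₁ w₂ →
      (dist w₁ w₂ ≤ a * (1 + 1 / 50) →
          1 / 4 * (‖perpTo (v - y) (w₁ - y)‖ * ‖perpTo (v - y) (w₂ - y)‖) ≤
            ⟪perpTo (v - y) (w₁ - y), perpTo (v - y) (w₂ - y)⟫) ∧
      (a * (63 / 50) ≤ dist w₁ w₂ →
          ⟪perpTo (v - y) (w₁ - y), perpTo (v - y) (w₂ - y)⟫ ≤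
            1 / 10 * (‖perpTo (v - y) (w₁ - y)‖ * ‖perpTo (v - y) (w₂ - y)‖))) →
    ∀ (Y : Set (EuclideanSpace ℝ (Fin 3))) (a : ℝ), 0 < a → Y.Finite →
      (∀ p ∈ Y, ∀ q ∈ Y, p ≠ q → a * (1 - 1 / 50) ≤ dist p q ∧
        (dist p q ≤ a * (1 + 1 / 50) ∨ a * (63 / 50) ≤ dist p q)) →
      (∀ z ∈ Y, {w ∈ Y | w ≠ z ∧ dist z w ≤ a * (1 + 1 / 50)}.ncard ≤ 12) →
      ∀ y ∈ Y,
        (∀ z ∈ Y, dist y z ≤ a * 3 → {w ∈ Y | w ≠ z ∧ dist z w ≤ a * (1 + 1 / 50)}.ncard = 12) →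
        ∀ v ∈ Y, v ≠ y → dist y v ≤ a * (1 + 1 / 50) →
          {w ∈ Y | w ≠ y ∧ w ≠ v ∧ dist y w ≤ a * (1 + 1 / 50) ∧
              dist v w ≤ a * (1 + 1 / 50)}.ncard ≤ 3 →
          ∀ e : EuclideanSpace ℝ (Fin 3), ‖e‖ = 1 → ⟪e, v - y⟫ = 0 →
            (∀ w ∈ Y, w ≠ y → w ≠ v → dist y w ≤ a * (1 + 1 / 50) →
              dist v w ≤ a * (1 + 1 / 50) → ⟪w - y, e⟫ ≤ 1 / 2 * ‖perpTo (v - y) (w - y)‖) →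
            False := by
  intro stub_tfNoReflexVoid stub_tfNoFarTriad hwin Y a ha hfin hgap hle y hy htw v hv hvy hdv h3 _e _he1 _heb _hsec
  -- the common-neighbour set of the bond
  set C : Set (EuclideanSpace ℝ (Fin 3)) := {w ∈ Y | w ≠ y ∧ w ≠ v ∧
      dist y w ≤ a * (1 + 1 / 50) ∧ dist v w ≤ a * (1 + 1 / 50)} with hC
  have hCfin : C.Finite := hfin.subset fun w hw => hw.1
  have hb : v - y ≠ 0 := sub_ne_zero.mpr hvy
  have hyv1 : a * (1 - 1 / 50) ≤ dist y v := (hgap y hy v hv hvy.symm).1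
  -- feeding `stub_tfNoReflexVoid` from a closed half-plane containing `C`
  have reflex : ∀ e' : EuclideanSpace ℝ (Fin 3), ‖e'‖ = 1 → ⟪e', v - y⟫ = 0 →
      (∀ w ∈ C, ⟪w - y, e'⟫ ≤ 0) → False := fun e' he'1 he'b hC0 =>
    stub_tfNoReflexVoid Y a ha hfin hgap hle y hy htw v hv hvy hdv h3 e' he'1 he'b
      fun w hw hwy hwv hdy hdvw => hC0 w ⟨hw, hwy, hwv, hdy, hdvw⟩
  rcases Nat.lt_or_ge C.ncard 3 with hlt | hge
  · /- `c ≤ 2`: the (at most two) commons lie in a closed half-plane (`stub_tfCircleTwo`). -/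
    obtain ⟨w', hw'⟩ := tfvd_enum2 hCfin (by omega) y
    obtain ⟨e', he'1, he'b, hq⟩ := stub_tfCircleTwo (v - y) hb
      (fun i => perpTo (v - y) (w' i - y)) fun i => inner_perpTo_left (v - y) (w' i - y)
    refine reflex e' he'1 he'b fun w hw => ?_
    obtain ⟨i, rfl⟩ := hw' w hw
    rw [tfvd_inner_eq (v - y) (w' i - y) e' he'b]
    exact hq i
  · /- `c = 3`: three distinct commons. -/
    have hC3 : C.ncard = 3 := le_antisymm h3 hge
    obtain ⟨w₁, w₂, w₃, h12, h13, h23, hCeq⟩ := Set.ncard_eq_three.mp hC3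
    have hw₁ : w₁ ∈ C := by rw [hCeq]; simp
    have hw₂ : w₂ ∈ C := by rw [hCeq]; simp
    have hw₃ : w₃ ∈ C := by rw [hCeq]; simp
    have hcov : ∀ w ∈ C, w = w₁ ∨ w = w₂ ∨ w = w₃ := fun w hw => by
      rw [hCeq] at hw
      simpa only [Set.mem_insert_iff, Set.mem_singleton_iff] using hw
    -- distance bookkeeping for a common `u ∈ C`
    have lo_y : ∀ u ∈ C, a * (1 - 1 / 50) ≤ dist y u := fun u hu =>
      (hgap y hy u hu.1 hu.2.1.symm).1
    have lo_v : ∀ u ∈ C, a * (1 - 1 / 50) ≤ dist v u := fun u hu =>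
      (hgap v hv u hu.1 hu.2.2.1.symm).1
    have lo_uu : ∀ u ∈ C, ∀ u' ∈ C, u ≠ u' → a * (1 - 1 / 50) ≤ dist u u' := fun u hu u' hu' h =>
      (hgap u hu.1 u' hu'.1 h).1
    have far_uu : ∀ u ∈ C, ∀ u' ∈ C, u ≠ u' → ¬ dist u u' ≤ a * (1 + 1 / 50) →
        a * (63 / 50) ≤ dist u u' := fun u hu u' hu' h hn =>
      ((hgap u hu.1 u' hu'.1 h).2).resolve_left hn
    -- the T-sector window for a bonded pair of commons `(u, u')`
    have winT : ∀ u ∈ C, ∀ u' ∈ C, u ≠ u' → dist u u' ≤ a * (1 + 1 / 50) →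
        1 / 4 * (‖perpTo (v - y) (u - y)‖ * ‖perpTo (v - y) (u' - y)‖) ≤
          ⟪perpTo (v - y) (u - y), perpTo (v - y) (u' - y)⟫ := fun u hu u' hu' h hd =>
      (hwin a ha y v u u' hyv1 hdv (lo_y u hu) hu.2.2.2.1 (lo_v u hu) hu.2.2.2.2
        (lo_y u' hu') hu'.2.2.2.1 (lo_v u' hu') hu'.2.2.2.2 (lo_uu u hu u' hu' h)).1 hd
    -- HUB case: `u₂` bonded to `u₁` and `u₃`, and `C ⊆ {u₁, u₂, u₃}` ⇒ reflex void
    have hub : ∀ u₁ u₂ u₃, u₁ ∈ C → u₂ ∈ C → u₃ ∈ C → u₁ ≠ u₂ → u₃ ≠ u₂ →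
        (∀ w ∈ C, w = u₁ ∨ w = u₂ ∨ w = u₃) →
        dist u₁ u₂ ≤ a * (1 + 1 / 50) → dist u₃ u₂ ≤ a * (1 + 1 / 50) → False := by
      intro u₁ u₂ u₃ hu₁ hu₂ hu₃ hn12 hn32 hcov' hd12 hd32
      have hq₂ : perpTo (v - y) (u₂ - y) ≠ 0 := by
        have hpl := stub_tfPerpLower a ha y v u₂ hyv1 hdv (lo_y u₂ hu₂) hu₂.2.2.2.1
          (lo_v u₂ hu₂) hu₂.2.2.2.2
        have hpos : 0 < ‖perpTo (v - y) (u₂ - y)‖ := lt_of_lt_of_le (by positivity) hpl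
        exact norm_pos_iff.mp hpos
      obtain ⟨e', he'1, he'b, hq1, hq2, hq3⟩ := stub_tfReflexHub (v - y) hb
        (perpTo (v - y) (u₁ - y)) (perpTo (v - y) (u₂ - y)) (perpTo (v - y) (u₃ - y))
        (inner_perpTo_left _ _) (inner_perpTo_left _ _) (inner_perpTo_left _ _) hq₂
        (winT u₁ hu₁ u₂ hu₂ hn12 hd12) (winT u₃ hu₃ u₂ hu₂ hn32 hd32)
      refine reflex e' he'1 he'b fun w hw => ?_
      rw [tfvd_inner_eq (v - y) (w - y) e' he'b]
      rcases hcov' w hw with rfl | rfl | rfl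
      · exact hq1.trans (by nlinarith [norm_nonneg (perpTo (v - y) (w - y))])
      · exact hq2.trans (by nlinarith [norm_nonneg (perpTo (v - y) (w - y))])
      · exact hq3.trans (by nlinarith [norm_nonneg (perpTo (v - y) (w - y))])
    -- FAR case: `u₃` bonded to neither `u₁` nor `u₂` ⇒ far triad
    have far : ∀ u₁ u₂ u₃, u₁ ∈ C → u₂ ∈ C → u₃ ∈ C → u₁ ≠ u₂ → u₁ ≠ u₃ → u₂ ≠ u₃ →
        ¬ dist u₁ u₃ ≤ a * (1 + 1 / 50) → ¬ dist u₂ u₃ ≤ a * (1 + 1 / 50) → False := by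
      intro u₁ u₂ u₃ hu₁ hu₂ hu₃ hn12 hn13 hn23 hf13 hf23
      exact stub_tfNoFarTriad Y a ha hfin hgap hle y hy htw v hv hvy hdv h3
        u₁ hu₁.1 u₂ hu₂.1 u₃ hu₃.1
        hu₁.2.1 hu₁.2.2.1 hu₁.2.2.2.1 hu₁.2.2.2.2
        hu₂.2.1 hu₂.2.2.1 hu₂.2.2.2.1 hu₂.2.2.2.2
        hu₃.2.1 hu₃.2.2.1 hu₃.2.2.2.1 hu₃.2.2.2.2
        hn12 hn13 hn23 (far_uu u₁ hu₁ u₃ hu₃ hn13 hf13) (far_uu u₂ hu₂ u₃ hu₃ hn23 hf23)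
    -- who is bonded to whom among `w₁, w₂, w₃`
    by_cases b12 : dist w₁ w₂ ≤ a * (1 + 1 / 50)
    · by_cases b23 : dist w₂ w₃ ≤ a * (1 + 1 / 50)
      · -- hub `w₂`
        exact hub w₁ w₂ w₃ hw₁ hw₂ hw₃ h12 h23.symm hcov b12 (by rwa [dist_comm] at b23)
      · by_cases b13 : dist w₁ w₃ ≤ a * (1 + 1 / 50)
        · -- hub `w₁`
          refine hub w₂ w₁ w₃ hw₂ hw₁ hw₃ h12.symm h13.symm (fun w hw => ?_)
            (by rwa [dist_comm] at b12) (by rwa [dist_comm] at b13)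
          rcases hcov w hw with h | h | h
          · exact Or.inr (Or.inl h)
          · exact Or.inl h
          · exact Or.inr (Or.inr h)
        · -- `w₃` isolated
          exact far w₁ w₂ w₃ hw₁ hw₂ hw₃ h12 h13 h23 b13 b23
    · by_cases b23 : dist w₂ w₃ ≤ a * (1 + 1 / 50)
      · by_cases b13 : dist w₁ w₃ ≤ a * (1 + 1 / 50)
        · -- hub `w₃`
          refine hub w₁ w₃ w₂ hw₁ hw₃ hw₂ h13 h23 (fun w hw => ?_) b13 b23
          rcases hcov w hw with h | h | h
          · exact Or.inl h
          · exact Or.inr (Or.inr h)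
          · exact Or.inr (Or.inl h)
        · -- `w₁` isolated
          refine far w₂ w₃ w₁ hw₂ hw₃ hw₁ h23 h12.symm h13.symm ?_ ?_
          · rwa [dist_comm] at b12
          · rwa [dist_comm] at b13
      · -- `w₂` isolated
        refine far w₁ w₃ w₂ hw₁ hw₃ hw₂ h13 h12 h23.symm b12 ?_
        rwa [dist_comm] at b23

end Summit.AtomisticToContinuum.Crystallization.Theorems

end
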